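import Summits.CriticalPhenomena.Ising3D.Control2DOpeEpsTail
import Summits.CriticalPhenomena.Ising3D.Control2DOpeEpsTwoSided
import Mathlib.Tactic.Linarith
import Mathlib.Tactic.Positivity
import HarnessLib

/-!
# Kind `ope2eps`, both senses, from the cells record + box checks on the TRUNCATED scalar block (analytic consumers)
(cell `pub-ising3x`, seat controls-1 gen 21; KERNEL PATH for the 2D γ-certificates, kind `ope2eps` (the `λ²_σσε` datum) — CONTROL-ONLY)

HONEST FRAMING: lottery ticket; floor = tightest certified 3D Ising CFT bounds; no exact-solution
claim without a proof. CONTROL-ONLY (`d = 2`, axiom set `A2D′`); nothing numerical is asserted here.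

`Control2DOpeEpsTwoSided` (controls-1 g13) proved `OpeEpsA2DObligations.opeEpsUpper_taylor / opeEpsLower_taylor`: the obligations
record of a Taylor functional plus the SIGN of `φ[F_-[g_{Δ,0}]]` on the `ε` box (upper: `> 0`; lower: a uniform margin
`2^Δ φ[F_-[g_{Δ,0}]] ≤ -σ < 0`) give `OpeEpsUpperA2D` (`W < P̃`) / `OpeEpsLowerA2D` (`P̃ < W`). This file is the bridge to what a kernel
replay of a certificate decides — everything on TRUNCATED blocks: the kind-`ope2eps` cells record `OpeEpsCellsN` (the box kind's
WITHOUT the `ε`-box row — for this kind the in-box scalars are the TARGET; the stress-tensor point IS a positivity row), the region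
inequality (R), and per box cell (I″) `0 < φ[F_-[1]] + P̃·2^Δ φ[F_-[Q_N(Δ,0)]]` (which LIFTS to the full block because the truncated block
under-estimates it, `phi_QN_le_block_taylor`, and `P̃, 2^Δ > 0`) together with
* UPPER: `0 < φ[F_-[Q_N(Δ,0)]]` on the box (lifts the same way) — `opeEpsUpper_half_of_cellsN`;
* LOWER: `2^Δ φ[F_-[Q_N(Δ,0)]] + (1/2)^{2s}·2W·σ_N(2S_N + σ_N) ≤ -σ` on the box, `σ > 0` — by the Δ-uniform tail majorant
  `phi_block0_le_QN_add_tail` of `Control2DOpeEpsTail` (`0 ≤ e₁`, `e₂ ≤ 2`, `Λ < N + 3`) — `opeEpsLower_half_of_cellsN`.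
The integer forms (Bernstein certificates of `P̂₀(y) - 1 ≥ 0`, of `Pd·identZ·4^{Nd}·D₀(y)² + Pn·P̂₀(y) - 1 ≥ 0` and of
`-(P̂₀(y) + K·D₀(y)²) - 1 ≥ 0` on the box cell) and the generator branch are the successor's (KP8/README §6 (iv)).
PROVED; no facts, standard axioms only. [cite: RattazziEtAl2008, §5]
-/

namespace Summit.CriticalPhenomena.Ising3D.Control2D

open Finset Set
open Literature.MathematicalPhysics.QuantumFieldTheory.ConformalBootstrap3D

/-- **The cells of a kind-`ope2eps` certificate** for the table functional at `Δ_σ = s` under `A2D′`: (C′) `ℓ = 0` on `[G, E₀)`,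
(T) the stress-tensor point `(2,2)`, `ℓ = 2` on `[2+δ, E₀)`, even `ℓ ≥ 4` on `[ℓ, E₀)`, each with its own truncation witness
(no `ε`-box row: the in-box scalars are the target of this kind). [cite: RattazziEtAl2008, §5.5] -/
def OpeEpsCellsN (S : Finset (ℕ × ℕ)) (w : ℕ × ℕ → ℝ) (s G δ E₀ : ℝ) : Prop :=
  (∀ Δ : ℝ, G ≤ Δ → Δ < E₀ → ∃ N : ℕ, E₀ ≤ N ∧
      0 ≤ taylorFunctional2D (1 / 2) S w (crossF s (-1) (QN N 0 Δ))) ∧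
  (∃ N : ℕ, E₀ ≤ N ∧ 0 ≤ taylorFunctional2D (1 / 2) S w (crossF s (-1) (QN N 2 2))) ∧
  (∀ Δ : ℝ, 2 + δ ≤ Δ → Δ < E₀ → ∃ N : ℕ, E₀ ≤ N ∧
      0 ≤ taylorFunctional2D (1 / 2) S w (crossF s (-1) (QN N 2 Δ))) ∧
  (∀ ℓ : ℕ, Even ℓ → ℓ ≠ 0 → ℓ ≠ 2 → ∀ Δ : ℝ, (ℓ : ℝ) ≤ Δ → Δ < E₀ → ∃ N : ℕ, E₀ ≤ N ∧
      0 ≤ taylorFunctional2D (1 / 2) S w (crossF s (-1) (QN N ℓ Δ)))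

/-- A kind-`box` cells record contains the kind-`ope2eps` one. [folklore] -/
theorem BoxCellsN.opeEpsCellsN {S : Finset (ℕ × ℕ)} {w : ℕ × ℕ → ℝ} {s G δ e₁ e₂ E₀ : ℝ}
    (h : BoxCellsN S w s G δ e₁ e₂ E₀) : OpeEpsCellsN S w s G δ E₀ :=
  ⟨h.2.1, h.2.2.1, h.2.2.2.1, h.2.2.2.2⟩

/-- The obligations record of a kind-`ope2eps` certificate from the cells record, (R) and a (lifted) (I″) on the box — the common part
of both senses. [cite: RattazziEtAl2008, §5.5] -/
theorem opeEpsObligations_half_of_cellsN (S : Finset (ℕ × ℕ)) (w : ℕ × ℕ → ℝ) {s G δ e₁ e₂ P E₀ : ℝ}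
    (hG : 2 * s < G) (hδ : 0 ≤ δ)
    (hI : ∀ Δ : ℝ, e₁ ≤ Δ → Δ ≤ e₂ →
      0 < taylorFunctional2D (1 / 2) S w (crossF s (-1) (fun _ _ => (1 : ℝ))) +
        P * ((2 : ℝ) ^ Δ * taylorFunctional2D (1 / 2) S w (crossF s (-1) (globalBlock Δ 0))))
    (hR : ∀ (b : ℝ) (J : ℕ), 0 ≤ b → E₀ ≤ 2 * b + J →
      0 ≤ ∑ p ∈ S, w p * ((1 - (-1 : ℝ) ^ (p.1 + p.2)) * 2 ^ (p.1 + p.2) *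
        (qFactor₁ s (b + J) p.1 * qFactor₁ s b p.2 + qFactor₁ s b p.1 * qFactor₁ s (b + J) p.2)))
    (hc : OpeEpsCellsN S w s G δ E₀) (hs0 : 0 ≤ s) :
    OpeEpsA2DObligations (taylorFunctional2D (1 / 2) S w) s G δ e₁ e₂ P E₀ := by
  have hφ := isTaylorFunctional_taylorFunctional2D (1 / 2) S w
  have hx0 : (0 : ℝ) < 1 / 2 := by norm_num
  have hx1 : (1 / 2 : ℝ) < 1 := by norm_num
  have hpair : PairPositiveAbove (taylorFunctional2D (1 / 2) S w) s E₀ := pairPositiveAbove_half_of_poly S w hR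
  have hcell : ∀ (ℓ : ℕ) (Δ : ℝ), (ℓ : ℝ) ≤ Δ →
      (∃ N : ℕ, E₀ ≤ N ∧ 0 ≤ taylorFunctional2D (1 / 2) S w (crossF s (-1) (QN N ℓ Δ))) →
      BlockPositive (taylorFunctional2D (1 / 2) S w) s Δ ℓ := by
    intro ℓ Δ hℓΔ hQ
    rcases le_or_gt E₀ Δ with hge | hlt
    · exact high_nonneg_of_pairPositive_taylor hφ hx0 hx1 hpair ℓ Δ hℓΔ hge
    · obtain ⟨N, hN, h⟩ := hQ
      have : (0 : ℝ) ≤ ℓ := Nat.cast_nonneg ℓ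
      exact blockPositive_of_QN_nonneg_taylor hφ hx0 hx1 hpair (N := N) hℓΔ (by linarith) h
  refine ⟨hI, ?_, ?_, ?_, ?_, ?_⟩
  · intro Δ h1 h2
    exact hcell 0 Δ (by simp only [Nat.cast_zero]; linarith) (hc.1 Δ h1 h2)
  · exact hcell 2 2 (by norm_num) hc.2.1
  · intro Δ h1 h2
    exact hcell 2 Δ (by push_cast; linarith) (hc.2.2.1 Δ h1 h2)
  · intro ℓ hℓ hℓ0 hℓ2 Δ hℓΔ hΔE
    exact hcell ℓ Δ hℓΔ (hc.2.2.2 ℓ hℓ hℓ0 hℓ2 Δ hℓΔ hΔE)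
  · exact fun ℓ _ Δ hℓΔ hge => high_nonneg_of_pairPositive_taylor hφ hx0 hx1 hpair ℓ Δ hℓΔ hge

/-- **Kind `ope2eps`, sense UPPER, at `(1/2,1/2)` from the cells record** (`0 ≤ s < 1`, `2s < e₁`, `2s < G`, `δ ≥ 0`, `P > 0`):
per box cell a truncation `N` with `E₀ ≤ Δ + N`, `0 < φ[F_-[Q_N(Δ,0)]]` and (I″) on the truncated block, plus (R) and `OpeEpsCellsN`,
give `OpeEpsUpperA2D s G δ e₁ e₂ P` (`W < P`). PROVED (both box statements lift by `phi_QN_le_block_taylor`; then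
`OpeEpsA2DObligations.opeEpsUpper_taylor`). [cite: RattazziEtAl2008, §5] -/
theorem opeEpsUpper_half_of_cellsN (S : Finset (ℕ × ℕ)) (w : ℕ × ℕ → ℝ) {s G δ e₁ e₂ P E₀ : ℝ}
    (hs0 : 0 ≤ s) (hs1 : s < 1) (he : 2 * s < e₁) (hG : 2 * s < G) (hδ : 0 ≤ δ) (hP : 0 < P)
    (hbox : ∀ Δ : ℝ, e₁ ≤ Δ → Δ ≤ e₂ → ∃ N : ℕ, E₀ ≤ Δ + N ∧
      0 < taylorFunctional2D (1 / 2) S w (crossF s (-1) (QN N 0 Δ)) ∧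
      0 < taylorFunctional2D (1 / 2) S w (crossF s (-1) (fun _ _ => (1 : ℝ))) +
        P * ((2 : ℝ) ^ Δ * taylorFunctional2D (1 / 2) S w (crossF s (-1) (QN N 0 Δ))))
    (hR : ∀ (b : ℝ) (J : ℕ), 0 ≤ b → E₀ ≤ 2 * b + J →
      0 ≤ ∑ p ∈ S, w p * ((1 - (-1 : ℝ) ^ (p.1 + p.2)) * 2 ^ (p.1 + p.2) *
        (qFactor₁ s (b + J) p.1 * qFactor₁ s b p.2 + qFactor₁ s b p.1 * qFactor₁ s (b + J) p.2)))
    (hc : OpeEpsCellsN S w s G δ E₀) : OpeEpsUpperA2D s G δ e₁ e₂ P := by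
  have hφ := isTaylorFunctional_taylorFunctional2D (1 / 2) S w
  have hx0 : (0 : ℝ) < 1 / 2 := by norm_num
  have hx1 : (1 / 2 : ℝ) < 1 := by norm_num
  have hpair : PairPositiveAbove (taylorFunctional2D (1 / 2) S w) s E₀ := pairPositiveAbove_half_of_poly S w hR
  -- the truncated block under-estimates the full one on every box cell
  have hlift : ∀ Δ : ℝ, e₁ ≤ Δ → Δ ≤ e₂ →
      0 < taylorFunctional2D (1 / 2) S w (crossF s (-1) (globalBlock Δ 0)) ∧
      0 < taylorFunctional2D (1 / 2) S w (crossF s (-1) (fun _ _ => (1 : ℝ))) +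
        P * ((2 : ℝ) ^ Δ * taylorFunctional2D (1 / 2) S w (crossF s (-1) (globalBlock Δ 0))) := by
    intro Δ h1 h2
    obtain ⟨N, hN, hQ, hIQ⟩ := hbox Δ h1 h2
    have hle := phi_QN_le_block_taylor hφ hx0 hx1 hpair (Δ := Δ) (ℓ := 0) (N := N)
      (by simp only [Nat.cast_zero]; linarith) hN
    have h2Δ : (0 : ℝ) < (2 : ℝ) ^ Δ := Real.rpow_pos_of_pos (by norm_num) _
    refine ⟨lt_of_lt_of_le hQ hle, ?_⟩
    have : P * ((2 : ℝ) ^ Δ * taylorFunctional2D (1 / 2) S w (crossF s (-1) (QN N 0 Δ))) ≤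
        P * ((2 : ℝ) ^ Δ * taylorFunctional2D (1 / 2) S w (crossF s (-1) (globalBlock Δ 0))) :=
      mul_le_mul_of_nonneg_left (mul_le_mul_of_nonneg_left hle h2Δ.le) hP.le
    linarith
  have hob := opeEpsObligations_half_of_cellsN S w hG hδ (fun Δ h1 h2 => (hlift Δ h1 h2).2) hR hc hs0
  exact OpeEpsA2DObligations.opeEpsUpper_taylor hφ hx0 hx1 he hG hs1 hob hP fun Δ h1 h2 => (hlift Δ h1 h2).1

/-- **Kind `ope2eps`, sense LOWER, at `(1/2,1/2)` from the cells record** (`0 ≤ s < 1`, `2s < e₁`, `2s < G`, `e₁ ≤ e₂ ≤ 2`, `δ ≥ 0`,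
`P > 0`, table indices `≤ Λ`, ONE truncation `N` for the box with `E₀ ≤ e₁ + N` and `Λ < N + 3`, margin `σ > 0`): per box cell (I″) on
the truncated block and the SIGN CHECK `2^Δ φ[F_-[Q_N(Δ,0)]] + (1/2)^{2s}·2W·σ_N(2S_N+σ_N) ≤ -σ` (`σ_N = 4·tailMajor Λ (N+2)`,
`S_N = headMajor Λ N`), plus (R) and `OpeEpsCellsN`, give `OpeEpsLowerA2D s G δ e₁ e₂ P` (`P < W`). PROVED ((I″) lifts;
`phi_block0_le_QN_add_tail` bounds the full block from above, `2^Δ (1/2)^Δ = 1`; then `opeEpsLower_taylor`). [cite: RattazziEtAl2008, §5] -/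
theorem opeEpsLower_half_of_cellsN (S : Finset (ℕ × ℕ)) (w : ℕ × ℕ → ℝ) {s G δ e₁ e₂ P E₀ σ : ℝ} {Λ N : ℕ}
    (hs0 : 0 ≤ s) (hs1 : s < 1) (he : 2 * s < e₁) (hG : 2 * s < G) (he12 : e₁ ≤ e₂) (he2 : e₂ ≤ 2)
    (hδ : 0 ≤ δ) (hP : 0 < P) (hσ : 0 < σ) (hΛ : ∀ p ∈ S, p.1 ≤ Λ ∧ p.2 ≤ Λ) (hNE : E₀ ≤ e₁ + N) (hNΛ : Λ < N + 3)
    (hbox : ∀ Δ : ℝ, e₁ ≤ Δ → Δ ≤ e₂ →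
      (2 : ℝ) ^ Δ * taylorFunctional2D (1 / 2) S w (crossF s (-1) (QN N 0 Δ)) +
          (1 / 2 : ℝ) ^ s * (1 / 2 : ℝ) ^ s * (2 * absWeight S w) *
            ((4 * tailMajor Λ (N + 2)) * (2 * headMajor Λ N + 4 * tailMajor Λ (N + 2))) ≤ -σ ∧
      0 < taylorFunctional2D (1 / 2) S w (crossF s (-1) (fun _ _ => (1 : ℝ))) +
        P * ((2 : ℝ) ^ Δ * taylorFunctional2D (1 / 2) S w (crossF s (-1) (QN N 0 Δ))))
    (hR : ∀ (b : ℝ) (J : ℕ), 0 ≤ b → E₀ ≤ 2 * b + J →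
      0 ≤ ∑ p ∈ S, w p * ((1 - (-1 : ℝ) ^ (p.1 + p.2)) * 2 ^ (p.1 + p.2) *
        (qFactor₁ s (b + J) p.1 * qFactor₁ s b p.2 + qFactor₁ s b p.1 * qFactor₁ s (b + J) p.2)))
    (hc : OpeEpsCellsN S w s G δ E₀) : OpeEpsLowerA2D s G δ e₁ e₂ P := by
  have hφ := isTaylorFunctional_taylorFunctional2D (1 / 2) S w
  have hx0 : (0 : ℝ) < 1 / 2 := by norm_num
  have hx1 : (1 / 2 : ℝ) < 1 := by norm_num
  have hpair : PairPositiveAbove (taylorFunctional2D (1 / 2) S w) s E₀ := pairPositiveAbove_half_of_poly S w hR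
  set T : ℝ := (1 / 2 : ℝ) ^ s * (1 / 2 : ℝ) ^ s * (2 * absWeight S w) *
    ((4 * tailMajor Λ (N + 2)) * (2 * headMajor Λ N + 4 * tailMajor Λ (N + 2))) with hT
  have hlift : ∀ Δ : ℝ, e₁ ≤ Δ → Δ ≤ e₂ →
      (2 : ℝ) ^ Δ * taylorFunctional2D (1 / 2) S w (crossF s (-1) (globalBlock Δ 0)) ≤ -σ ∧
      0 < taylorFunctional2D (1 / 2) S w (crossF s (-1) (fun _ _ => (1 : ℝ))) +
        P * ((2 : ℝ) ^ Δ * taylorFunctional2D (1 / 2) S w (crossF s (-1) (globalBlock Δ 0))) := by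
    intro Δ h1 h2
    obtain ⟨hX, hIQ⟩ := hbox Δ h1 h2
    have hΔ0 : 0 ≤ Δ := by linarith
    have hle := phi_QN_le_block_taylor hφ hx0 hx1 hpair (Δ := Δ) (ℓ := 0) (N := N)
      (by simp only [Nat.cast_zero]; linarith) (by linarith)
    have hup := phi_block0_le_QN_add_tail S w hs0 hs1.le hΛ hΔ0 (by linarith) hNΛ
    have h2Δ : (0 : ℝ) < (2 : ℝ) ^ Δ := Real.rpow_pos_of_pos (by norm_num) _
    have hone : (2 : ℝ) ^ Δ * (1 / 2 : ℝ) ^ Δ = 1 := by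
      rw [← Real.mul_rpow (by norm_num) (by norm_num)]; norm_num
    constructor
    · -- `2^Δ φ[g] ≤ 2^Δ φ[Q_N] + 2^Δ (1/2)^Δ T = 2^Δ φ[Q_N] + T ≤ -σ`
      have hmul := mul_le_mul_of_nonneg_left hup h2Δ.le
      have hexp : (2 : ℝ) ^ Δ * (taylorFunctional2D (1 / 2) S w (crossF s (-1) (QN N 0 Δ)) +
          (1 / 2 : ℝ) ^ s * (1 / 2 : ℝ) ^ s * (1 / 2 : ℝ) ^ Δ * (2 * absWeight S w) *
            ((4 * tailMajor Λ (N + 2)) * (2 * headMajor Λ N + 4 * tailMajor Λ (N + 2)))) =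
          (2 : ℝ) ^ Δ * taylorFunctional2D (1 / 2) S w (crossF s (-1) (QN N 0 Δ)) + ((2 : ℝ) ^ Δ * (1 / 2 : ℝ) ^ Δ) * T := by
        rw [hT]; ring
      rw [hexp, hone, one_mul] at hmul
      linarith
    · have : P * ((2 : ℝ) ^ Δ * taylorFunctional2D (1 / 2) S w (crossF s (-1) (QN N 0 Δ))) ≤
          P * ((2 : ℝ) ^ Δ * taylorFunctional2D (1 / 2) S w (crossF s (-1) (globalBlock Δ 0))) :=
        mul_le_mul_of_nonneg_left (mul_le_mul_of_nonneg_left hle h2Δ.le) hP.le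
      linarith
  have hob := opeEpsObligations_half_of_cellsN S w hG hδ (fun Δ h1 h2 => (hlift Δ h1 h2).2) hR hc hs0
  exact OpeEpsA2DObligations.opeEpsLower_taylor hφ hx0 hx1 he hG hs1 hob hP he12 hσ fun Δ h1 h2 => (hlift Δ h1 h2).1

end Summit.CriticalPhenomena.Ising3D.Control2D
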